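import Summits.BirchSwinnertonDyer.BirchSwinnertonDyer.Theorems.Rank1ResidualJetThm63KernelInputsCM
import Summits.BirchSwinnertonDyer.BirchSwinnertonDyer.Theorems.Rank1ResidualJetRowDuality
import HarnessLib

/-!
# T1 JET (cell `bsd-jet`), road K: [J] Thm 5.2 at a core vertex with the two POITOU–TATE PACKAGES
# plugged in — the H63 line reduced to named print + local inputs

HONEST FRAMING (programme file §HONESTY, verbatim): «no tranche here proves BSD; ARM L moves the
LITERAL column of an r ≤ 1 census into the kernel-proved-modulo-named-print column.» THEOREMS ONLY
(seat `bsd-jet-pv-2`, session g4; `--supports stmt-BirchSwinnertonDyer-14418`, helper); 0 classes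
move. WHAT THIS IS. `JET.tamagawaExponent_le_mInfty_of_kernelInputs'` (p502116) is printed Thm. 5.2
at a core vertex with the kernel bricks of session g3 plugged in; its remaining STRUCTURE-LEVEL
hypotheses were the carrier set `Qcar` with its disjointness, the sign `e'`, the dual module `C'` and
the two Poitou–Tate packages (`hC`, `hdual_q`, `hdual_ℓ`). This file supplies them BY NAME:
* the transverse family stays a PARAMETER `𝒯` with its reconciliation `hT` (for the family of local
  images `loc_λ(⋂ transverseKer ℓ)` the reconciliation is the tree theorem `exists_transverseFamily`,
  p505818, from gap G2 `exists_localRestriction_compat`, p505076; it is kept abstract here so that the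
  two LOCAL properties `h𝒯σ`/`h𝒯sd` below can be supplied for whichever rendering of Jetchev's
  `H¹_tr(K_λ)` the completion layer settles on);
* `C'`, `hC`, `hdual_q`, `hdual_ℓ` := pv-1's `GlobalDuality.exists_rowDuality_modified` (p506535: Jetchev
  Thm. 5.1 at the carrier pair + Lemma 5.2 (iii) at the Kolyvagin primes, from the named fact
  `poitouTate_selmerStructure_duality_conj K`, a `τ`-equivariant Weil datum, and local inputs);
* `Qcar := {v₀, τ • v₀}` for a place `v₀` of `K` over the conductor with `τ • v₀ ≠ v₀` (the carrier
  prime splits in `K` by the Heegner hypothesis); the disjointness `hQcar` is DERIVED (`c` is prime to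
  the conductor); the sign `e' = ε(−1)^{#primes of c}` is internal.
What is LEFT as hypotheses is exactly: named print {`h44` = [McC] Prop. 4.4 (typed), `h53` = Gross 1991
Prop. 5.3 (cite-only), `hGZ` = [GZ86 III (3.1)] receptacle (cite-only), `hPT` = Poitou–Tate for Selmer
structures (named fact)}; the Weil datum `e` with its `τ`-equivariance `hτe` (Silverman III.8.1; the
tree's `exists_weilPairing` gives all clauses but `hτe`); and the LOCAL inputs, each a statement about
ONE completion: `htr` / `h49tr` (transverse membership of `c_k(c)`, `c_k(cℓ)` at the primes of `c`),
`h49str` (stringent membership of `c_k(cℓ)` at the carrier pair — Jetchev Prop. 4.9 proper), `h𝒯σ` /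
`h𝒯sd` (the local transverse condition is `τ`-stable and self-dual, [J] §3.1.2), `h𝒮σ` (the stringent
family is `τ`-stable at the carrier pair), `hcyc` / `hidx` ((δ): `Kum_{v₀}/𝒮_{v₀}` cyclic of order `p^t`;
the count is `relIndex_stringentFamily_eq_pow`, p503010), `hloc` (Lemma 5.2 (i)–(ii): the `±`-parts of
`H¹(K_λ, E[p^k])/Kum_λ` have order `p^k` at the Kolyvagin primes `λ ∤ c`). CONCLUSION `t ≤ m_∞`.
References: [cite: Jetchev2008, Thm. 5.2 (p. 821) and proof (pp. 821–823); §3.1.2 (p. 814); Lemma 5.2;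
Prop. 4.9 (p. 820)] [cite: McCallumLMS1991, §4 Prop. 4.4] [cite: GrossLMS1991, Prop. 5.3, Prop. 6.2 (1)]
[cite: GrossZagier1986, III (3.1)] [cite: MilneADT2006, Ch. I, Thm. 4.10(b)] [cite: SilvermanAEC2009,
Prop. III.8.1].
-/

set_option autoImplicit false

noncomputable section

open scoped Classical Pointwise

open WeierstrassCurve IsDedekindDomain NumberField Field Literature.NumberTheory.EllipticCurves
  Literature.NumberTheory.EllipticCurves.ModularForms Literature.NumberTheory.EllipticCurves.Jetchev2008
  Literature.NumberTheory.GaloisRepresentations Literature.NumberTheory.GaloisCohomology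
  Literature.NumberTheory.GaloisRepresentations.DiscreteGaloisModule
  Summit.BirchSwinnertonDyer.Rank1Residual.X11b
  Summit.BirchSwinnertonDyer.Rank1Residual.JET.SelmerVocabulary Literature.NumberTheory.Automorphic

namespace Summit.BirchSwinnertonDyer.Rank1Residual.JET

/-- **[J] Thm 5.2 at a core vertex, reduced to local inputs** — `tamagawaExponent_le_mInfty_of_kernelInputs'`
with the two Poitou–Tate packages (`GlobalDuality.exists_rowDuality_modified`) plugged in, the carrier
set the split pair `{v₀, τ • v₀}` over the conductor and the sign internal; see the module docstring for the exact list of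
what remains (named print `h44`/`h53`/`hGZ`/`hPT`, the `τ`-equivariant Weil datum, and the local inputs
`htr`, `h49str`, `h49tr`, `h𝒯σ`, `h𝒯sd`, `h𝒮σ`, `hcyc`, `hidx`, `hloc`). CONCLUSION: `t ≤ m_∞`.
[cite: Jetchev2008, Thm. 5.2 (p. 821) and proof (pp. 821–823)] [cite: McCallumLMS1991, §4 Prop. 4.4]
[cite: GrossLMS1991, Prop. 5.3, Prop. 6.2 (1)] [cite: GrossZagier1986, III (3.1)]
[cite: MilneADT2006, Ch. I, Thm. 4.10(b)] -/
theorem tamagawaExponent_le_mInfty_of_localInputs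
    (h44 : McCallum1991.prop44_localOrder_kolyvaginClass_mul_eq)
    (W : WeierstrassCurve ℚ) [W.IsElliptic] [W.IsGloballyMinimal] [NeZero (W.conductorNorm ℤ)]
    (hcm : ¬ W.HasCM) (K : Type) [Field K] [NumberField K] (hK : IsImaginaryQuadratic K)
    (hD3 : NumberField.discr K ≠ -3) (hD4 : NumberField.discr K ≠ -4)
    (hH : SatisfiesHeegnerHypothesis (W.conductorNorm ℤ) K)
    -- Poitou–Tate duality for Selmer structures, conjugation-compatible form (named fact)
    (hPT : poitouTate_selmerStructure_duality_conj K)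
    (p : ℕ) [Fact p.Prime] (hp2 : p ≠ 2) (htower : ∀ n : ℕ, W.HasSurjectiveModNGaloisRep (p ^ n : ℕ))
    (Dt : ModularParametrizationData W (W.conductorNorm ℤ)) (β : ℤ) (ι : K →+* ℂ)
    [∀ j : ℕ, NumberField (ringClassField K ι j)]
    (τ : K ≃ₐ[ℚ] K) (hτ : τ ≠ 1) (hτ2 : τ * τ = 1)
    -- Gross Prop. 5.3 for the Fricke sign `ε` (cite-only named input)
    (ε : ℤ) (hε : ε = 1 ∨ ε = -1)
    (h53 : ∀ (m : ℕ) (dm : KolyvaginHeegnerData Dt β ι m)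
      (τm : ringClassField K ι m ≃ₐ[ℚ] ringClassField K ι m),
      (∀ x : ringClassField K ι m, ((τm x : ringClassField K ι m) : ℂ) = starRingEnd ℂ x) →
      ∃ σ' ∈ ringClassGal ι m, IsOfFinAddOrder
        (pointGalHom W (ringClassField K ι m) τm dm.y -
          ε • pointGalHom W (ringClassField K ι m) σ' dm.y))
    -- [GZ86 III (3.1)] in the receptacle form, with `n'` prime to `p` (cite-only named input)
    {n' : ℤ} (hcop' : IsCoprime (p : ℤ) n')
    (hGZ : ∀ (m : ℕ) (dm : KolyvaginHeegnerData Dt β ι m)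
      (γ : ringClassField K ι m ≃ₐ[ℚ] ringClassField K ι m), γ ∈ ringClassGal ι m →
      ∀ v : HeightOneSpectrum (𝓞 K), ¬ (W.baseChange K).HasGoodReductionAt v →
        n' • pointsMap (W.baseChange K) (v.adicCompletion K)
            (dm.toGeomPoints (pointGalHom W (ringClassField K ι m) γ dm.y)) ∈
          E0Receptacle (W.baseChange K) v ∧
        ∀ (ℓ : ℕ), ℓ ∈ m.primeFactors → ∀ (dm' : KolyvaginHeegnerData Dt β ι (m / ℓ))
          (hle : ringClassField K ι (m / ℓ) ≤ ringClassField K ι m),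
          n' • pointsMap (W.baseChange K) (v.adicCompletion K)
              (dm.toGeomPoints (pointGalHom W (ringClassField K ι m) γ
                (WeierstrassCurve.Affine.Point.map (W' := W)
                  ((RingClassField.inclusion ι hle).restrictScalars ℚ) dm'.y))) ∈
            E0Receptacle (W.baseChange K) v)
    -- the `H63` binder's bookkeeping
    (mdiv m : {c : ℕ // Squarefree c ∧ ∀ ℓ ∈ c.primeFactors,
        Zhang2014.IsKolyvaginPrime (W.conductorNorm ℤ) W K p ℓ} → ℕ∞)
    (hmdiv : ∀ c (u : ℕ), (u : ℕ∞) ≤ mdiv c ↔ ∀ d : KolyvaginHeegnerData Dt β ι c.1,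
      ∃ Q : (W.baseChange (ringClassField K ι c.1)).toAffine.Point,
        ((p ^ u : ℕ) : ℤ) • Q = d.derivedPoint)
    (hm : ∀ c, m c = if mdiv c < Zhang2014.levelIndex W p c.1 then mdiv c else ⊤)
    (k : ℕ) [NeZero (p ^ k)] [Finite (geomTorsion (W.baseChange K) ((p ^ k : ℕ) : ℤ))]
    (c : {c : ℕ // Squarefree c ∧ ∀ ℓ ∈ c.primeFactors,
        Zhang2014.IsKolyvaginPrime (W.conductorNorm ℤ) W K p ℓ}) (hk : 1 ≤ k)
    (hcore : IsGlobalCoreVertex W K ι τ p k c.1) (mInf : ℕ) (hmc : m c = mInf)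
    (hkM : (k : ℕ∞) + mInf ≤ Zhang2014.levelIndex W p c.1)
    (t : ℕ) (htk : t < k) (hik : mInf < k)
    -- a Weil pairing datum on `E[p^k]` over `K`, equivariant under the lift of `τ`
    (e : geomTorsion (W.baseChange K) ((p ^ k : ℕ) : ℤ) →
      geomTorsion (W.baseChange K) ((p ^ k : ℕ) : ℤ) → AlgebraicClosure K)
    (hμ : ∀ S T, e S T ^ (p ^ k) = 1)
    (hadd₁ : ∀ S₁ S₂ T, e (S₁ + S₂) T = e S₁ T * e S₂ T)
    (hadd₂ : ∀ S T₁ T₂, e S (T₁ + T₂) = e S T₁ * e S T₂)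
    (hgal : ∀ (g : absoluteGaloisGroup K) (S T : geomTorsion (W.baseChange K) ((p ^ k : ℕ) : ℤ)),
      g • e S T = e (g • S) (g • T))
    (halt : ∀ T, e T T = 1) (hnondeg : ∀ T, (∀ S, e S T = 1) → T = 0)
    (hτe : ∀ S T, liftAut τ (e S T) =
      e ((isLiftOfAut_liftAut τ).torsionMap W ((p ^ k : ℕ) : ℤ) S)
        ((isLiftOfAut_liftAut τ).torsionMap W ((p ^ k : ℕ) : ℤ) T))
    -- the transverse family with its reconciliation (e.g. `exists_transverseFamily`)
    (𝒯 : SelmerStructure ((W.baseChange K).torsionGaloisModule ((p ^ k : ℕ) : ℤ)))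
    (hT : ∀ x : galoisCohomology ((W.baseChange K).torsionGaloisModule ((p ^ k : ℕ) : ℤ)) 1,
      (∀ w ∈ placesDividing K c.1,
        galoisCohomology.localization ((W.baseChange K).torsionGaloisModule ((p ^ k : ℕ) : ℤ))
          (Sum.inr w) 1 x ∈ 𝒯 (Sum.inr w)) ↔
      ∀ ℓ ∈ c.1.primeFactors, x ∈ transverseKer W K ι ((p ^ k : ℕ) : ℤ) ℓ)
    -- LOCAL INPUT: the local transverse condition is `τ`-stable ([J] §3.1.2)
    (h𝒯σ : ∀ (v w : HeightOneSpectrum (𝓞 K)) (h : τ • v = w), v ∈ placesDividing K c.1 →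
      ∀ x : galoisCohomology (((W.baseChange K).torsionGaloisModule ((p ^ k : ℕ) : ℤ)).toLocal
        (Sum.inr v : Place K)) 1,
      x ∈ 𝒯 (Sum.inr v) → conjActPlace W τ ((p ^ k : ℕ) : ℤ) h x ∈ 𝒯 (Sum.inr w))
    -- LOCAL INPUT: the local transverse condition is self-dual ([J] §3.1.2, [MR04] 1.3.2)
    (h𝒯sd : ∀ inv : LocalInvariants K (p ^ k), inv.IsPerfect → ∀ v ∈ placesDividing K c.1,
      inv.dualTransported 𝒯 (weilDualIntertwining (W.baseChange K) (p ^ k) e hμ hadd₁ hadd₂ hgal)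
        (Sum.inr v) = 𝒯 (Sum.inr v))
    -- the stringent family below the Kummer family
    (𝒮 : SelmerStructure ((W.baseChange K).torsionGaloisModule ((p ^ k : ℕ) : ℤ)))
    (hS : ∀ v, 𝒮 v ≤ (W.baseChange K).kummerSelmerStructure ((p ^ k : ℕ) : ℤ) v)
    -- the carrier: a place `v₀` over the conductor, split (`τ • v₀ ≠ v₀`)
    (v₀ : HeightOneSpectrum (𝓞 K)) (hv₀ : τ • v₀ ≠ v₀)
    (hv₀N : ((W.conductorNorm ℤ : ℕ) : 𝓞 K) ∈ v₀.asIdeal)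
    -- LOCAL INPUT: the stringent family is `τ`-stable at the carrier pair
    (h𝒮σ : ∀ (v w : HeightOneSpectrum (𝓞 K)) (h : τ • v = w), v ∈ ({v₀, τ • v₀} : Finset _) →
      ∀ x : galoisCohomology (((W.baseChange K).torsionGaloisModule ((p ^ k : ℕ) : ℤ)).toLocal
        (Sum.inr v : Place K)) 1,
      x ∈ 𝒮 (Sum.inr v) → conjActPlace W τ ((p ^ k : ℕ) : ℤ) h x ∈ 𝒮 (Sum.inr w))
    -- LOCAL INPUT (δ): `Kum_{v₀}/𝒮_{v₀}` cyclic of order `p^t`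
    (hcyc : IsAddCyclic (↥((W.baseChange K).kummerSelmerStructure ((p ^ k : ℕ) : ℤ) (Sum.inr v₀)) ⧸
      (𝒮 (Sum.inr v₀)).addSubgroupOf
        ((W.baseChange K).kummerSelmerStructure ((p ^ k : ℕ) : ℤ) (Sum.inr v₀))))
    (hidx : (𝒮 (Sum.inr v₀)).relIndex
      ((W.baseChange K).kummerSelmerStructure ((p ^ k : ℕ) : ℤ) (Sum.inr v₀)) = p ^ t)
    -- LOCAL INPUT (Lemma 5.2 (i)–(ii)): the `±`-parts of `H¹(K_λ, E[p^k])/Kum_λ` at Kolyvagin `λ ∤ c`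
    (hloc : ∀ ℓ : ℕ, Zhang2014.IsKolyvaginPrime (W.conductorNorm ℤ) W K p ℓ →
      k ≤ Zhang2014.kolyvaginIndex W p ℓ → ℓ ∉ c.1.primeFactors →
      ∀ (v : HeightOneSpectrum (𝓞 K)), (ℓ : 𝓞 K) ∈ v.asIdeal → ∀ (hfix : τ • v = v)
        (s : ℤ), s = 1 ∨ s = -1 →
      ((W.baseChange K).kummerSelmerStructure ((p ^ k : ℕ) : ℤ) (Sum.inr v)).relIndex
        ((conjActPlace W τ ((p ^ k : ℕ) : ℤ) hfix - s • AddMonoidHom.id _).ker) = p ^ k)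
    -- KERNEL GAP (completion layer): the transverse condition of `c_k(c)` at the primes of `c`
    (htr : ∀ (d : KolyvaginHeegnerData Dt β ι c.1), ∀ ℓ ∈ c.1.primeFactors,
      (d.kolyvaginClass (Fact.out : p.Prime) k :
        galoisCohomology ((W.baseChange K).torsionGaloisModule ((p ^ k : ℕ) : ℤ)) 1) ∈
        transverseKer W K ι ((p ^ k : ℕ) : ℤ) ℓ)
    -- KERNEL GAPS (completion layer): Prop 4.9♯ for the classes at `cℓ` — stringent part at the
    -- carrier pair and transverse part at the primes of `c`
    (h49str : ∀ (ℓ : ℕ), Zhang2014.IsKolyvaginPrime (W.conductorNorm ℤ) W K p ℓ →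
      k ≤ Zhang2014.kolyvaginIndex W p ℓ → ℓ ∉ c.1.primeFactors →
      ∀ (d' : KolyvaginHeegnerData Dt β ι (c.1 * ℓ)), ∀ q ∈ ({v₀, τ • v₀} : Finset _),
      galoisCohomology.localization ((W.baseChange K).torsionGaloisModule ((p ^ k : ℕ) : ℤ))
          (Sum.inr q) 1 (d'.kolyvaginClass (Fact.out : p.Prime) k) ∈ 𝒮 (Sum.inr q))
    (h49tr : ∀ (ℓ : ℕ), Zhang2014.IsKolyvaginPrime (W.conductorNorm ℤ) W K p ℓ →
      k ≤ Zhang2014.kolyvaginIndex W p ℓ → ℓ ∉ c.1.primeFactors →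
      ∀ (d' : KolyvaginHeegnerData Dt β ι (c.1 * ℓ)), ∀ w ∈ placesDividing K c.1,
      galoisCohomology.localization ((W.baseChange K).torsionGaloisModule ((p ^ k : ℕ) : ℤ))
          (Sum.inr w) 1 (d'.kolyvaginClass (Fact.out : p.Prime) k) ∈ 𝒯 (Sum.inr w)) :
    t ≤ mInf := by
  have hp : p.Prime := Fact.out
  have hc0 : c.1 ≠ 0 := c.2.1.ne_zero
  -- the sign `e' = ε(−1)^r ∈ {±1}` and `s = −e'`
  set e' : ℤ := ε * (-1) ^ c.1.primeFactors.card with he'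
  have hs : -e' = 1 ∨ -e' = -1 := by
    rcases hε with h | h <;> rcases neg_one_pow_eq_or ℤ c.1.primeFactors.card with h' | h' <;>
      simp [he', h, h']
  -- the carrier pair is disjoint from the places dividing `c` (`c` is prime to the conductor)
  have hcopN : Nat.Coprime c.1 (W.conductorNorm ℤ) := by
    refine Nat.coprime_of_dvd fun q hq hqc hqN ↦ ?_
    exact (c.2.2 q (Nat.mem_primeFactors.mpr ⟨hq, hqc, hc0⟩)).2.1 hqN
  have hQc : Disjoint ({v₀, τ • v₀} : Finset (HeightOneSpectrum (𝓞 K))) (placesDividing K c.1) := by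
    rw [Finset.disjoint_left]
    intro v hv hvc
    have hcv : (c.1 : 𝓞 K) ∈ v.asIdeal := (mem_placesDividing_iff_natCast_mem hc0 v).mp hvc
    simp only [Finset.mem_insert, Finset.mem_singleton] at hv
    rcases hv with rfl | rfl
    · exact Literature.NumberTheory.NumberFields.Honda1971.natCast_notMem_of_coprime hcopN _ hcv hv₀N
    · refine Literature.NumberTheory.NumberFields.Honda1971.natCast_notMem_of_coprime hcopN _ hcv ?_
      have := (HeightOneSpectrum.smul_mem_smul_asIdeal_iff τ v₀ ((W.conductorNorm ℤ : ℕ) : 𝓞 K)).mpr hv₀N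
      rwa [GlobalDuality.smul_natCast_ringOfIntegers] at this
  -- the two Poitou–Tate packages (pv-1, by name)
  obtain ⟨C', hC, hdual_q, hdual_ℓ⟩ := GlobalDuality.exists_rowDuality_modified W τ p k e hμ hadd₁ hadd₂
    hgal halt hnondeg hτe hPT ι hτ2 hp2 hk 𝒯 𝒮 hc0 hT h𝒯σ h𝒯sd hS v₀ hv₀ hQc h𝒮σ hcyc hidx
    (W.conductorNorm ℤ) hv₀N hs
    (fun ℓ h1 h2 h3 v hv hfix ↦ hloc ℓ h1 h2 h3 v hv hfix (-e') hs)
  -- assemble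
  exact tamagawaExponent_le_mInfty_of_kernelInputs' h44 W hcm K hK hD3 hD4 hH p hp2 htower Dt β ι τ hτ
    ε hε h53 hcop' hGZ mdiv m hmdiv hm k c hk hcore mInf hmc hkM t htk hik 𝒯 𝒮 hT hS {v₀, τ • v₀} hQc
    e' he' C' hC htr hdual_q h49str h49tr hdual_ℓ

end Summit.BirchSwinnertonDyer.Rank1Residual.JET

end
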